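import Summits.AtomisticToContinuum.Crystallization.Theorems.FrustratedLawDichotomyStrainedPatchHomSlopeLeaf

/-!
# Radius-safe per-label curvature coefficients: `ρ = 2·√(q/4)` (sequel of `…HomCurvDispatch`; fixes the `FI.sqrt` range for `q ≥ 16`)

decomp-a2c hand-1 g26 (crux `AperiodicFrustratedLawGap`, stmt-AtomisticToContinuum-27623; `λ`-leaf of lever (C)).  MEASURED (g26, `#eval`): the
library square root `FI.sqrt` (Newton from `2⁵⁰`) is tight only for arguments `< 16`; for a window-regime label with `q ≈ 19.8` it returns
`[4.0, 5.6e15]`, which makes the window enclosures of `…HomCurvCoeffW` sound but useless (Hessian entries `±1e44` for the 360-label sum).  This file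
re-derives the window coefficients and the dispatcher with the RESCALED radius `rhoFI Q := 2·FI.sqrt (Q/4)` (`√q = 2√(q/4)`; `q/4 < 16` for every
label radius `< 8`), keeping every other ingredient (bump / Lennard-Jones enclosures, flags, hulls) from the landed files:

* §1 `rhoFI`, `mem_rhoFI`;  §2 `betaWinFI2`, `alphaWinFI2` + soundness (bodies of `…HomCurvCoeffW` with `rhoFI`);
* §3 `coeffFI2` + ★★★ `mem_coeffFI2` (off the junctions) and ★ `mem_coeffFI2_beta` (β at every radius).

Kernel definitions + soundness; 0 sorry; standard axioms; no instances / notation / `#eval`.  `--supports stmt-AtomisticToContinuum-27623`.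
-/

noncomputable section

namespace Summit.AtomisticToContinuum.Crystallization.Theorems.FrustratedLawDichotomyStrainedPatchHomCurvCoeff

open Literature.Analysis.ValidatedNumerics.Numerics
open Summit.AtomisticToContinuum.Crystallization.Theorems.FrustratedLawDichotomySchurCut (effPot w₄₅ ω₄)
open Summit.AtomisticToContinuum.Crystallization.Theorems.FrustratedLawDichotomyStrainedPatchHomForceKit (phiFI mem_phiFI)
open Summit.AtomisticToContinuum.Crystallization.Theorems.FrustratedLawDichotomyStrainedPatchHomCurvRegime
open Summit.AtomisticToContinuum.Crystallization.Theorems.FrustratedLawDichotomyStrainedPatchTaylorLeaves (junctions)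
open Summit.AtomisticToContinuum.Crystallization.Theorems.FrustratedLawDichotomyStrainedPatchHomTermCalculus (deriv_effPot45_far)
open Summit.AtomisticToContinuum.Crystallization.Theorems.FrustratedLawDichotomyStrainedPatchHomCurvLeaf
  (beta_bump_closed beta_lj_closed beta_window_closed canB_of_le)

/-! ## §1. The rescaled radius -/

/-- `ρ = 2·√(q/4)`: the library square root applied below `16`. -/
def rhoFI (Q : FI) : FI := (FI.sqrt (Q.divNat 4)).mulInt 2

/-- [folklore] -/
theorem mem_rhoFI {ρ : ℝ} (hρ : 0 ≤ ρ) {Q : FI} (hq : FI.mem (ρ ^ 2) Q) : FI.mem ρ (rhoFI Q) := by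
  have h4 := FI.mem_divNat hq (n := 4) (by norm_num)
  have hs := FI.mem_sqrt h4
  have e : Real.sqrt (ρ ^ 2 / (4 : ℕ)) = ρ / 2 := by
    rw [show (ρ ^ 2 / (4 : ℕ) : ℝ) = (ρ / 2) ^ 2 by push_cast; ring, Real.sqrt_sq (by linarith)]
  rw [e] at hs
  have := FI.mem_mulInt hs 2
  push_cast at this
  simpa [rhoFI] using this

/-! ## §2. Window coefficients with the rescaled radius -/

/-- ★ `β` in the window regime (`none` iff `Q` reaches `0`). -/
def betaWinFI2 (Q : FI) : Option FI :=
  match phiFI Q, FI.divPos (FI.ofInt 1) Q with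
  | some P, some u =>
    let R := rhoFI Q
    some ((P.mul (cWinFI R)).add ((((vljFI u).mul (c1WinFI R)).mul R).mul u))
  | _, _ => none

/-- ★ Soundness of `betaWinFI2` (`ρ ≥ 0`, `q = ρ²`). [folklore] -/
theorem mem_betaWinFI2 {ρ : ℝ} (hρ : 0 ≤ ρ) {Q B : FI} (hq : FI.mem (ρ ^ 2) Q) (h : betaWinFI2 Q = some B) :
    FI.mem ((((ρ ^ 2)⁻¹) ^ 4 - ((ρ ^ 2)⁻¹) ^ 7) * ((16 * ρ ^ 3 - 180 * ρ ^ 2 + 648 * ρ - 729) / 27) +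
      (1 / 12 * ((ρ ^ 2)⁻¹) ^ 6 - 1 / 6 * ((ρ ^ 2)⁻¹) ^ 3) * ((16 * ρ ^ 2 - 120 * ρ + 216) / 9) * ρ * (ρ ^ 2)⁻¹) B := by
  unfold betaWinFI2 at h
  cases hP : phiFI Q with
  | none => rw [hP] at h; exact absurd h (by simp)
  | some P =>
    cases hu : FI.divPos (FI.ofInt 1) Q with
    | none => rw [hP, hu] at h; exact absurd h (by simp)
    | some u =>
      rw [hP, hu] at h
      simp only [Option.some.injEq] at h
      subst h
      have hPm := mem_phiFI hq hP
      have huu : FI.mem ((ρ ^ 2)⁻¹) u := by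
        have := FI.mem_divPos hu (by simpa using FI.mem_ofInt 1) hq
        simpa [one_div] using this
      have hR : FI.mem ρ (rhoFI Q) := mem_rhoFI hρ hq
      exact FI.mem_add (FI.mem_mul hPm (mem_cWinFI hR))
        (FI.mem_mul (FI.mem_mul (FI.mem_mul (mem_vljFI huu) (mem_c1WinFI hR)) hR) huu)

/-- ★ `α` in the window regime (`none` iff `Q` reaches `0`). -/
def alphaWinFI2 (Q : FI) : Option FI :=
  match phiFI Q, alphaLJFI Q, FI.divPos (FI.ofInt 1) Q with
  | some P, some A, some u =>
    let R := rhoFI Q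
    let V := vljFI u
    let c1 := c1WinFI R
    some ((A.mul (cWinFI R)).add
      ((((((R.mulInt 2).mul P).mul c1).sub (((V.mul c1).mul R).mul u)).add (V.mul (c2WinFI R))).mul u))
  | _, _, _ => none

/-- ★ Soundness of `alphaWinFI2`. [folklore] -/
theorem mem_alphaWinFI2 {ρ : ℝ} (hρ : 0 ≤ ρ) {Q A : FI} (hq : FI.mem (ρ ^ 2) Q) (h : alphaWinFI2 Q = some A) :
    FI.mem ((14 * ((ρ ^ 2)⁻¹) ^ 8 - 8 * ((ρ ^ 2)⁻¹) ^ 5) * ((16 * ρ ^ 3 - 180 * ρ ^ 2 + 648 * ρ - 729) / 27) +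
      (2 * ρ * (((ρ ^ 2)⁻¹) ^ 4 - ((ρ ^ 2)⁻¹) ^ 7) * ((16 * ρ ^ 2 - 120 * ρ + 216) / 9) -
        (1 / 12 * ((ρ ^ 2)⁻¹) ^ 6 - 1 / 6 * ((ρ ^ 2)⁻¹) ^ 3) * ((16 * ρ ^ 2 - 120 * ρ + 216) / 9) * ρ * (ρ ^ 2)⁻¹ +
        (1 / 12 * ((ρ ^ 2)⁻¹) ^ 6 - 1 / 6 * ((ρ ^ 2)⁻¹) ^ 3) * ((32 * ρ - 120) / 9)) * (ρ ^ 2)⁻¹) A := by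
  unfold alphaWinFI2 at h
  cases hP : phiFI Q with
  | none => rw [hP] at h; exact absurd h (by simp)
  | some P =>
    cases hA : alphaLJFI Q with
    | none => rw [hP, hA] at h; exact absurd h (by simp)
    | some A0 =>
      cases hu : FI.divPos (FI.ofInt 1) Q with
      | none => rw [hP, hA, hu] at h; exact absurd h (by simp)
      | some u =>
        rw [hP, hA, hu] at h
        simp only [Option.some.injEq] at h
        subst h
        have hPm := mem_phiFI hq hP
        have hAm := mem_alphaLJFI hq hA
        have huu : FI.mem ((ρ ^ 2)⁻¹) u := by
          have := FI.mem_divPos hu (by simpa using FI.mem_ofInt 1) hq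
          simpa [one_div] using this
        have hR : FI.mem ρ (rhoFI Q) := mem_rhoFI hρ hq
        have hV := mem_vljFI huu
        have hc := mem_cWinFI hR
        have hc1 := mem_c1WinFI hR
        have hc2 := mem_c2WinFI hR
        have h2ρ : FI.mem (ρ * (2 : ℤ)) ((rhoFI Q).mulInt 2) := FI.mem_mulInt hR 2
        have key := FI.mem_add (FI.mem_mul hAm hc)
          (FI.mem_mul (FI.mem_add (FI.mem_sub (FI.mem_mul (FI.mem_mul h2ρ hPm) hc1) (FI.mem_mul (FI.mem_mul (FI.mem_mul hV hc1) hR) huu))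
            (FI.mem_mul hV hc2)) huu)
        push_cast at key
        convert key using 2
        ring


/-! ## §3. ★★★ The dispatcher (radius-safe) and its soundness -/

/-- ★ **Per-label curvature coefficients** `(A ∋ α, B ∋ β)` from `Q ∋ ρ²`, hulled over the regimes `Q` can meet (`none` iff `Q` reaches `0` or is
empty of regimes). -/
def coeffFI2 (Q : FI) : Option (FI × FI) :=
  match alphaBumpFI Q, betaBumpFI Q, alphaLJFI Q, phiFI Q, alphaWinFI2 Q, betaWinFI2 Q with
  | some aB, some bB, some aL, some bL, some aW, some bW =>
    match sel Q aB aL aW, sel Q bB bL bW with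
    | some A, some B => some (A, B)
    | _, _ => none
  | _, _, _, _, _, _ => none

/-- ★★★ **SOUNDNESS OF THE DISPATCHER**: for every `ρ > 0` off the junction radii with `ρ² ∈ Q`, `coeffFI2 Q = some (A, B)` encloses
`α(ρ) = (W₄₅″(ρ) − W₄₅′(ρ)/ρ)/ρ² ∈ A` and `β(ρ) = W₄₅′(ρ)/ρ ∈ B` (`W₄₅ = effPot w₄₅ ω₄ (3/400) = Wrec`). [folklore chaining] -/
theorem mem_coeffFI2 {ρ : ℝ} (h0 : 0 < ρ) (hJ : ρ ∉ junctions) {Q : FI} (hq : FI.mem (ρ ^ 2) Q) {AB : FI × FI} (h : coeffFI2 Q = some AB) :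
    FI.mem ((deriv (deriv (effPot w₄₅ ω₄ (3 / 400))) ρ - deriv (effPot w₄₅ ω₄ (3 / 400)) ρ / ρ) / ρ ^ 2) AB.1 ∧
      FI.mem (deriv (effPot w₄₅ ω₄ (3 / 400)) ρ / ρ) AB.2 := by
  unfold coeffFI2 at h
  cases haB : alphaBumpFI Q with
  | none => rw [haB] at h; exact absurd h (by simp)
  | some aB =>
  cases hbB : betaBumpFI Q with
  | none => rw [haB, hbB] at h; exact absurd h (by simp)
  | some bB =>
  cases haL : alphaLJFI Q with
  | none => rw [haB, hbB, haL] at h; exact absurd h (by simp)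
  | some aL =>
  cases hbL : phiFI Q with
  | none => rw [haB, hbB, haL, hbL] at h; exact absurd h (by simp)
  | some bL =>
  cases haW : alphaWinFI2 Q with
  | none => rw [haB, hbB, haL, hbL, haW] at h; exact absurd h (by simp)
  | some aW =>
  cases hbW : betaWinFI2 Q with
  | none => rw [haB, hbB, haL, hbL, haW, hbW] at h; exact absurd h (by simp)
  | some bW =>
  rw [haB, hbB, haL, hbL, haW, hbW] at h
  simp only at h
  cases hSA : sel Q aB aL aW with
  | none => rw [hSA] at h; exact absurd h (by simp)
  | some A =>
  cases hSB : sel Q bB bL bW with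
  | none => rw [hSA, hSB] at h; exact absurd h (by simp)
  | some B =>
  rw [hSA, hSB] at h
  simp only [Option.some.injEq] at h
  subst h
  rcases regime_cases h0 hJ with hb | hl | hw | hf
  · have hc := canB_of hq hb.1 hb.2
    refine ⟨mem_sel_B hc ?_ hSA, mem_sel_B hc ?_ hSB⟩
    · rw [alpha_bump hb.1 hb.2]; exact mem_alphaBumpFI h0.le hq haB
    · rw [beta_bump hb.1 hb.2]; exact mem_betaBumpFI h0.le hq hbB
  · have hc := canL_of hq hl.1 hl.2
    refine ⟨mem_sel_L hc ?_ hSA, mem_sel_L hc ?_ hSB⟩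
    · rw [alpha_lj hl.1 hl.2]; exact mem_alphaLJFI hq haL
    · rw [beta_lj hl.1 hl.2]; exact mem_phiFI hq hbL
  · have hc := canW_of hq hw.1 hw.2
    refine ⟨mem_sel_W hc ?_ hSA, mem_sel_W hc ?_ hSB⟩
    · rw [alpha_window hw.1 hw.2]; exact mem_alphaWinFI2 h0.le hq haW
    · rw [beta_window hw.1 hw.2]; exact mem_betaWinFI2 h0.le hq hbW
  · have hc := canF_of hq hf
    refine ⟨?_, ?_⟩
    · rw [alpha_far hf]; exact mem_sel_F hc hSA
    · rw [beta_far hf]; exact mem_sel_F hc hSB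


/-! ## §4. `β` at every radius (junctions included) -/

/-- ★ **`β` membership WITHOUT a junction hypothesis**: for every `ρ > 0` with `ρ² ∈ Q` and `coeffFI2 Q = some (A, B)`, `W₄₅′(ρ)/ρ ∈ B`. [folklore] -/
theorem mem_coeffFI2_beta {ρ : ℝ} (h0 : 0 < ρ) {Q : FI} (hq : FI.mem (ρ ^ 2) Q) {AB : FI × FI} (h : coeffFI2 Q = some AB) :
    FI.mem (deriv (effPot w₄₅ ω₄ (3 / 400)) ρ / ρ) AB.2 := by
  by_cases hJ : ρ ∉ Summit.AtomisticToContinuum.Crystallization.Theorems.FrustratedLawDichotomyStrainedPatchTaylorLeaves.junctions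
  · exact (mem_coeffFI2 h0 hJ hq h).2
  have hJ' : ρ ∈ Summit.AtomisticToContinuum.Crystallization.Theorems.FrustratedLawDichotomyStrainedPatchTaylorLeaves.junctions := not_not.mp hJ
  have hcases : ρ = 8 / 5 ∨ ρ = 3 ∨ ρ = 9 / 2 := by
    simpa [Summit.AtomisticToContinuum.Crystallization.Theorems.FrustratedLawDichotomyStrainedPatchTaylorLeaves.junctions] using hJ'
  -- unpack `coeffFI` as in `mem_coeffFI`
  unfold coeffFI2 at h
  cases haB : alphaBumpFI Q with
  | none => rw [haB] at h; exact absurd h (by simp)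
  | some aB =>
  cases hbB : betaBumpFI Q with
  | none => rw [haB, hbB] at h; exact absurd h (by simp)
  | some bB =>
  cases haL : alphaLJFI Q with
  | none => rw [haB, hbB, haL] at h; exact absurd h (by simp)
  | some aL =>
  cases hbL : phiFI Q with
  | none => rw [haB, hbB, haL, hbL] at h; exact absurd h (by simp)
  | some bL =>
  cases haW : alphaWinFI2 Q with
  | none => rw [haB, hbB, haL, hbL, haW] at h; exact absurd h (by simp)
  | some aW =>
  cases hbW : betaWinFI2 Q with
  | none => rw [haB, hbB, haL, hbL, haW, hbW] at h; exact absurd h (by simp)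
  | some bW =>
  rw [haB, hbB, haL, hbL, haW, hbW] at h
  simp only at h
  cases hSA : sel Q aB aL aW with
  | none => rw [hSA] at h; exact absurd h (by simp)
  | some A =>
  cases hSB : sel Q bB bL bW with
  | none => rw [hSA, hSB] at h; exact absurd h (by simp)
  | some B =>
  rw [hSA, hSB] at h
  simp only [Option.some.injEq] at h
  subst h
  rcases hcases with rfl | rfl | rfl
  · -- ρ = 8/5: bump flag is raised, bump formula valid on the closed regime
    have hc := canB_of_le hq h0 le_rfl
    refine mem_sel_B hc ?_ hSB
    rw [beta_bump_closed h0 le_rfl]; exact mem_betaBumpFI h0.le hq hbB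
  · -- ρ = 3: either the LJ flag or the window flag is raised (else `sel` would have been `none` only if also far/bump fail — handle by cases)
    by_cases hL : canL Q = true
    · refine mem_sel_L hL ?_ hSB
      rw [beta_lj_closed (by norm_num) le_rfl]; exact mem_phiFI hq hbL
    · by_cases hW : canW Q = true
      · refine mem_sel_W hW ?_ hSB
        rw [beta_window_closed le_rfl (by norm_num)]; exact mem_betaWinFI2 h0.le hq hbW
      · -- both neighbouring flags down at q = 9 forces Q to be the point 9: then canB and canF are down too and `sel = none`
        exfalso
        have hS : (0 : ℝ) < SC := by norm_num [SC]
        simp only [canL, canW, decide_eq_true_eq, not_and_or, not_lt] at hL hW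
        have hq1 := hq.1; have hq2 := hq.2
        have h9lo : (FI.ofInt 9).lo = 9 * SC := rfl
        have h9hi : (FI.ofInt 9).hi = 9 * SC := rfl
        have ht1 : (FI.ofFrac 64 25).lo = 720575940379279 := by decide +kernel
        have ht3 : (FI.ofFrac 81 4).hi = 5699868278390784 := by decide +kernel
        norm_num at hq1 hq2
        rcases hL with hL | hL
        · rw [ht1] at hL
          have : (Q.hi : ℝ) ≤ 720575940379279 := by exact_mod_cast hL
          rw [SC] at hq2; push_cast at hq2; linarith
        rcases hW with hW | hW
        · rw [h9lo] at hW
          rw [h9hi] at hL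
          -- Q.hi ≤ 9·SC ≤ Q.lo: the point interval; then `canB` false and `canF` false, so `sel … = none`, contradiction with hSB
          -- here `hL : 9·SC ≤ Q.lo` and `hW : Q.hi ≤ 9·SC`
          have hB' : canB Q = false := by
            simp only [canB, decide_eq_false_iff_not, not_lt]
            have hhi : (FI.ofFrac 64 25).hi = 720575940379280 := by decide +kernel
            rw [hhi]
            have h' : ((9 * (SC : ℤ) : ℤ) : ℝ) ≤ (Q.lo : ℝ) := by exact_mod_cast hL
            rw [SC] at h'; push_cast at h'
            have : (720575940379280 : ℝ) ≤ Q.lo := by linarith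
            exact_mod_cast this
          have hF' : canF Q = false := by
            simp only [canF, decide_eq_false_iff_not, not_lt]
            have hlo3 : (FI.ofFrac 81 4).lo = 5699868278390784 := by decide +kernel
            rw [hlo3]
            have h' : ((Q.hi : ℤ) : ℝ) ≤ ((9 * (SC : ℤ) : ℤ) : ℝ) := by exact_mod_cast hW
            rw [SC] at h'; push_cast at h'
            have : (Q.hi : ℝ) ≤ 5699868278390784 := by linarith
            exact_mod_cast this
          have hLf : canL Q = false := by
            simp only [canL, decide_eq_false_iff_not, not_and_or, not_lt]; exact Or.inr (by rw [h9hi]; exact hL)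
          have hWf : canW Q = false := by
            simp only [canW, decide_eq_false_iff_not, not_and_or, not_lt]; exact Or.inl (by rw [h9lo]; exact hW)
          have : sel Q bB bL bW = none := by simp [sel, pick, hB', hF', hLf, hWf]
          rw [this] at hSB; exact absurd hSB (by simp)
        · rw [ht3] at hW
          have : (5699868278390784 : ℝ) ≤ Q.lo := by exact_mod_cast hW
          rw [SC] at hq1; push_cast at hq1; linarith
  · -- ρ = 9/2: window flag or far flag
    by_cases hW : canW Q = true
    · refine mem_sel_W hW ?_ hSB
      rw [beta_window_closed (by norm_num) le_rfl]; exact mem_betaWinFI2 h0.le hq hbW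
    · by_cases hF : canF Q = true
      · have hz : deriv (effPot w₄₅ ω₄ (3 / 400)) (9 / 2) / (9 / 2) = 0 := by rw [deriv_effPot45_far le_rfl, zero_div]
        rw [hz]; exact mem_sel_F hF hSB
      · exfalso
        simp only [canW, canF, decide_eq_true_eq, not_and_or, not_lt] at hW hF
        have hq1 := hq.1; have hq2 := hq.2
        have ht3lo : (FI.ofFrac 81 4).lo = 5699868278390784 := by decide +kernel
        have ht3hi : (FI.ofFrac 81 4).hi = 5699868278390784 := by decide +kernel
        have h9lo : (FI.ofInt 9).lo = 9 * SC := rfl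
        norm_num at hq1 hq2
        rw [ht3lo] at hF
        have hF' : (Q.hi : ℝ) ≤ 5699868278390784 := by exact_mod_cast hF
        rcases hW with hW | hW
        · rw [h9lo] at hW
          have h' : ((Q.hi : ℤ) : ℝ) ≤ ((9 * (SC : ℤ) : ℤ) : ℝ) := by exact_mod_cast hW
          rw [SC] at h' hq2; push_cast at h' hq2; linarith
        · rw [ht3hi] at hW
          have hW' : (5699868278390784 : ℝ) ≤ Q.lo := by exact_mod_cast hW
          -- point interval at 81/4: then canB, canL false too ⇒ sel = none
          have hB' : canB Q = false := by
            simp only [canB, decide_eq_false_iff_not, not_lt]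
            have hhi : (FI.ofFrac 64 25).hi = 720575940379280 := by decide +kernel
            rw [hhi]
            have : (720575940379280 : ℝ) ≤ Q.lo := by linarith
            exact_mod_cast this
          have hLf : canL Q = false := by
            simp only [canL, decide_eq_false_iff_not, not_and_or, not_lt]
            refine Or.inr ?_
            show (FI.ofInt 9).hi ≤ Q.lo
            have : ((FI.ofInt 9).hi : ℝ) ≤ Q.lo := by
              rw [show (FI.ofInt 9).hi = 9 * SC from rfl]; push_cast; rw [SC]; push_cast; linarith
            exact_mod_cast this
          have hWf : canW Q = false := by
            simp only [canW, decide_eq_false_iff_not, not_and_or, not_lt]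
            refine Or.inr ?_
            rw [ht3hi]; exact_mod_cast (show (5699868278390784 : ℝ) ≤ Q.lo from hW')
          have hFf : canF Q = false := by
            simp only [canF, decide_eq_false_iff_not, not_lt]; rw [ht3lo]; exact hF
          have : sel Q bB bL bW = none := by simp [sel, pick, hB', hFf, hLf, hWf]
          rw [this] at hSB; exact absurd hSB (by simp)


end Summit.AtomisticToContinuum.Crystallization.Theorems.FrustratedLawDichotomyStrainedPatchHomCurvCoeff

end
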